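import Summits.QuantumFields.QCD.Theorems.SmallFieldUltracontractivity.Negative.Tightness
import Literature.Probability.LatticeModels.TorusFourierProofs
import Literature.MathematicalPhysics.QuantumLattice.LatticeToriProofs
import Literature.MathematicalPhysics.QuantumLattice.YangMillsClassical
import Literature.MathematicalPhysics.QuantumFieldTheory.ConstructiveQFTWave0WilsonLoopRPProofs

/-!
# Helper file for the stub `stub_combGauge` of line `point-centred-axial-parabolic`
(crux `Summit.QuantumFields.QCD.Theses.HeatSlicedQuarks.SmallFieldUltracontractivity`, item stmt-QuantumFields-8871)

Definition-free ingredients of the comb (complete axial) gauge bound on a non-wrapping cube of the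
`L⁴` torus, consumed by `HeatSlicedQuarksSmallFieldUltracontractivityStubCombGauge.lean`; the file closes the
registered sub-goal `stub_combGaugeAxial` (the axial induction, stated for an abstract tree gauge and
cost function) and its riders live in the sub-namespace `…PointCentredAxialParabolic.CombGauge`:

* the Frobenius distance to the identity `F(V) = ‖V - 1‖_F` on `SU(3)` (scoped Frobenius norm
  `Matrix.Norms.Frobenius`): `F(V)² = 2 (3 - Re tr V)` (`norm_sub_one_sq`), subadditivity
  (`norm_mul_sub_one_le`), conjugation and inversion invariance;
* the transport identity `gaugeTransform_shift_eq`: if the two `ν`-links of the plaquette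
  `p = (y; ν, μ)` are gauged to `1`, then `W(y + ν̂, μ) = Ad_{g y}(U_p) · W(y, μ)` for `W = g • U`;
  its norm form `norm_transport` says that moving a `μ`-link one step along the axis `ν` costs at
  most `F(U_p)`, in either direction;
* torus bookkeeping for sites `x₀ + m`, `m ∈ ℕ⁴` (`torusDist_add_natCast_le`, `offset_bounds`):
  for `2R + 1 ≤ L` the offset representatives of a site `z` with `torusDist x z + 1 ≤ R` from the
  corner `x - (R,R,R,R)` are within `torusDist x z` of `R`;
* the axial induction (`step_bound`, `axis_bound`, `comb_bound`): for ANY gauge `g` that gauges the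
  links of the comb tree centred at the offset `(R,R,R,R)` to `1` (hypothesis `htl`; the tree is
  constructed in the main file), a `μ`-link at an offset within `D < R` of the centre is moved onto
  the tree along the axes `3, 2, 1` (those `> μ`) in at most `4 D` steps, whence
  `F(W) ≤ 4 D η` if every plaquette in the ball has `F(U_p) ≤ η`.
-/

noncomputable section

namespace Summit.QuantumFields.QCD.Cruxes.SmallFieldUltracontractivity.PointCentredAxialParabolic

open Literature.MathematicalPhysics.QuantumLattice Literature.MathematicalPhysics.QuantumFieldTheory
open Literature.Probability.LatticeModels (TorusSite)
open Summit.QuantumFields.QCD.Theorems.SmallFieldUltracontractivity.Negative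
open scoped Matrix ComplexConjugate Matrix.Norms.Frobenius

namespace CombGauge

/-! ### Frobenius distance to the identity on `SU(3)` -/

/-- `‖V - 1‖_F² = 2 (3 - Re tr V)` for `V ∈ SU(3)`: `(V-1)ᴴ(V-1) = 2 - V - Vᴴ`. -/
theorem norm_sub_one_sq (V : SU3) :
    ‖(V : Matrix (Fin 3) (Fin 3) ℂ) - 1‖ ^ 2 = 2 * (3 - (V : Matrix (Fin 3) (Fin 3) ℂ).trace.re) := by
  have hV : (V : Matrix (Fin 3) (Fin 3) ℂ)ᴴ * (V : Matrix (Fin 3) (Fin 3) ℂ) = 1 := by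
    have h := Matrix.mem_unitaryGroup_iff'.mp V.2.1
    rwa [Matrix.star_eq_conjTranspose] at h
  have h : ((V : Matrix (Fin 3) (Fin 3) ℂ) - 1)ᴴ * ((V : Matrix (Fin 3) (Fin 3) ℂ) - 1) =
      1 + 1 - (V : Matrix (Fin 3) (Fin 3) ℂ) - (V : Matrix (Fin 3) (Fin 3) ℂ)ᴴ := by
    rw [Matrix.conjTranspose_sub, Matrix.conjTranspose_one, sub_mul, mul_sub, mul_sub, one_mul,
      mul_one, one_mul, hV]
    abel
  rw [Matrix.frobenius_norm_sq_eq_re_trace, h, Matrix.trace_sub, Matrix.trace_sub,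
    Matrix.trace_add, Matrix.trace_one, Matrix.trace_conjTranspose, Fintype.card_fin]
  simp only [RCLike.re_to_complex, Complex.sub_re, Complex.add_re, Complex.star_def,
    Complex.conj_re, Nat.cast_ofNat, Complex.re_ofNat]
  ring

/-- Subadditivity `‖AB - 1‖_F ≤ ‖A - 1‖_F + ‖B - 1‖_F` on `SU(3)` (left unitary invariance). -/
theorem norm_mul_sub_one_le (A B : SU3) :
    ‖((A * B : SU3) : Matrix (Fin 3) (Fin 3) ℂ) - 1‖ ≤
      ‖(A : Matrix (Fin 3) (Fin 3) ℂ) - 1‖ + ‖(B : Matrix (Fin 3) (Fin 3) ℂ) - 1‖ := by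
  rw [Submonoid.coe_mul]
  have h : (A : Matrix (Fin 3) (Fin 3) ℂ) * (B : Matrix (Fin 3) (Fin 3) ℂ) - 1 =
      ((A : Matrix (Fin 3) (Fin 3) ℂ) - 1) +
        (A : Matrix (Fin 3) (Fin 3) ℂ) * ((B : Matrix (Fin 3) (Fin 3) ℂ) - 1) := by
    noncomm_ring
  have h2 : ‖(A : Matrix (Fin 3) (Fin 3) ℂ) * ((B : Matrix (Fin 3) (Fin 3) ℂ) - 1)‖ =
      ‖(B : Matrix (Fin 3) (Fin 3) ℂ) - 1‖ :=
    Matrix.frobenius_norm_unitaryGroup_mul ⟨(A : Matrix (Fin 3) (Fin 3) ℂ), A.2.1⟩ _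
  rw [h]
  exact (norm_add_le _ _).trans (by rw [h2])

/-- Conjugation invariance `‖T A T⁻¹ - 1‖_F = ‖A - 1‖_F` on `SU(3)`. -/
theorem norm_conj_sub_one (T A : SU3) :
    ‖((T * A * T⁻¹ : SU3) : Matrix (Fin 3) (Fin 3) ℂ) - 1‖ = ‖(A : Matrix (Fin 3) (Fin 3) ℂ) - 1‖ := by
  rw [Submonoid.coe_mul, Submonoid.coe_mul]
  have hT : (T : Matrix (Fin 3) (Fin 3) ℂ) * star (T : Matrix (Fin 3) (Fin 3) ℂ) = 1 :=
    Matrix.mem_unitaryGroup_iff.mp T.2.1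
  change ‖(T : Matrix (Fin 3) (Fin 3) ℂ) * (A : Matrix (Fin 3) (Fin 3) ℂ) *
      star (T : Matrix (Fin 3) (Fin 3) ℂ) - 1‖ = _
  have h : (T : Matrix (Fin 3) (Fin 3) ℂ) * (A : Matrix (Fin 3) (Fin 3) ℂ) *
        star (T : Matrix (Fin 3) (Fin 3) ℂ) - 1 =
      (T : Matrix (Fin 3) (Fin 3) ℂ) * ((A : Matrix (Fin 3) (Fin 3) ℂ) - 1) *
        star (T : Matrix (Fin 3) (Fin 3) ℂ) := by
    rw [mul_sub, sub_mul, mul_one, hT]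
  have h1 : ‖(T : Matrix (Fin 3) (Fin 3) ℂ) * ((A : Matrix (Fin 3) (Fin 3) ℂ) - 1) *
        star (T : Matrix (Fin 3) (Fin 3) ℂ)‖ =
      ‖(T : Matrix (Fin 3) (Fin 3) ℂ) * ((A : Matrix (Fin 3) (Fin 3) ℂ) - 1)‖ :=
    Matrix.frobenius_norm_mul_unitaryGroup _
      ⟨star (T : Matrix (Fin 3) (Fin 3) ℂ), Unitary.star_mem T.2.1⟩
  have h2 : ‖(T : Matrix (Fin 3) (Fin 3) ℂ) * ((A : Matrix (Fin 3) (Fin 3) ℂ) - 1)‖ =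
      ‖(A : Matrix (Fin 3) (Fin 3) ℂ) - 1‖ :=
    Matrix.frobenius_norm_unitaryGroup_mul ⟨(T : Matrix (Fin 3) (Fin 3) ℂ), T.2.1⟩ _
  rw [h, h1, h2]

/-- Inversion invariance `‖A⁻¹ - 1‖_F = ‖A - 1‖_F` on `SU(3)` (`A⁻¹ = Aᴴ`, `‖Xᴴ‖_F = ‖X‖_F`). -/
theorem norm_inv_sub_one (A : SU3) :
    ‖((A⁻¹ : SU3) : Matrix (Fin 3) (Fin 3) ℂ) - 1‖ = ‖(A : Matrix (Fin 3) (Fin 3) ℂ) - 1‖ := by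
  have h : star (A : Matrix (Fin 3) (Fin 3) ℂ) - 1 = ((A : Matrix (Fin 3) (Fin 3) ℂ) - 1)ᴴ := by
    rw [Matrix.conjTranspose_sub, Matrix.conjTranspose_one, Matrix.star_eq_conjTranspose]
  change ‖star (A : Matrix (Fin 3) (Fin 3) ℂ) - 1‖ = _
  rw [h, Matrix.frobenius_norm_conjTranspose]

/-! ### The transport identity -/

/-- **Transport identity.** If the two `ν`-links `(y, ν)` and `(y + μ̂, ν)` are gauged to `1`, then
`W(y + ν̂, μ) = g(y) U_p(y; ν, μ) g(y)⁻¹ · W(y, μ)` for the gauge-transformed links `W = g • U`. -/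
theorem gaugeTransform_shift_eq {G : Type*} [Group G] {d L : ℕ} (g : Site d L → G)
    (U : GaugeConfig d L G) (y : Site d L) (ν μ : Fin d) (h1 : gaugeTransform g U (y, ν) = 1)
    (h2 : gaugeTransform g U (y.shift μ, ν) = 1) :
    gaugeTransform g U (y.shift ν, μ) =
      g y * plaquetteHolonomy U y ν μ * (g y)⁻¹ * gaugeTransform g U (y, μ) := by
  simp only [gaugeTransform, plaquetteHolonomy] at *
  rw [mul_inv_eq_one] at h1 h2
  rw [WilsonRP.shift_comm y ν μ, ← h1, ← h2]
  group

/-- Norm form of the transport identity on `SU(3)`: moving a `μ`-link by one step along the axis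
`ν` costs at most the Frobenius deficit of one plaquette, in either direction. -/
theorem norm_transport {L : ℕ} (g : TorusSite 4 L → SU3) (U : GaugeConfig 4 L SU3)
    (y : TorusSite 4 L) (ν μ : Fin 4) (h1 : gaugeTransform g U (y, ν) = 1)
    (h2 : gaugeTransform g U (Site.shift y μ, ν) = 1) :
    ‖(↑(gaugeTransform g U (Site.shift y ν, μ)) : Matrix (Fin 3) (Fin 3) ℂ) - 1‖ ≤
        ‖(↑(plaquetteHolonomy U y ν μ) : Matrix (Fin 3) (Fin 3) ℂ) - 1‖ +
          ‖(↑(gaugeTransform g U (y, μ)) : Matrix (Fin 3) (Fin 3) ℂ) - 1‖ ∧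
      ‖(↑(gaugeTransform g U (y, μ)) : Matrix (Fin 3) (Fin 3) ℂ) - 1‖ ≤
        ‖(↑(plaquetteHolonomy U y ν μ) : Matrix (Fin 3) (Fin 3) ℂ) - 1‖ +
          ‖(↑(gaugeTransform g U (Site.shift y ν, μ)) : Matrix (Fin 3) (Fin 3) ℂ) - 1‖ := by
  have key := gaugeTransform_shift_eq g U y ν μ h1 h2
  have key' : gaugeTransform g U (y, μ) =
      (g y * plaquetteHolonomy U y ν μ * (g y)⁻¹)⁻¹ * gaugeTransform g U (Site.shift y ν, μ) := by
    rw [key]; group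
  constructor
  · rw [key]
    exact (norm_mul_sub_one_le _ _).trans (by rw [norm_conj_sub_one])
  · rw [key']
    exact (norm_mul_sub_one_le _ _).trans (by rw [norm_inv_sub_one, norm_conj_sub_one])

/-! ### Torus bookkeeping on the non-wrapping cube -/

/-- `update p ν a + e_ν = update p ν (a + 1)` for offsets. -/
theorem update_add_single (p : Fin 4 → ℕ) (ν : Fin 4) (a : ℕ) :
    (Function.update p ν a + Pi.single ν 1 : Fin 4 → ℕ) = Function.update p ν (a + 1) := by
  funext i
  by_cases h : i = ν
  · subst h; simp
  · simp [Function.update_of_ne h, Pi.single_eq_of_ne h]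

/-- The cyclic distance of the residues of two naturals is at most their distance in `ℕ`. -/
theorem cycAbs_natCast_sub_le {L : ℕ} (a b D : ℕ) (h1 : a ≤ b + D) (h2 : b ≤ a + D) :
    min ((a : ZMod L) - (b : ZMod L)).val (L - ((a : ZMod L) - (b : ZMod L)).val) ≤ D := by
  rcases le_total b a with hba | hab
  · rw [← Nat.cast_sub hba, ZMod.val_natCast]
    exact (min_le_left _ _).trans ((Nat.mod_le _ _).trans (by omega))
  · rw [show (a : ZMod L) - (b : ZMod L) = -((b - a : ℕ) : ZMod L) by
        rw [Nat.cast_sub hab]; ring, cyclicAbs_neg, ZMod.val_natCast]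
    exact (min_le_left _ _).trans ((Nat.mod_le _ _).trans (by omega))

/-- Sites `x₀ + p`, `x₀ + q` with close offsets `p, q ∈ ℕ⁴` are close on the torus. -/
theorem torusDist_add_natCast_le {L : ℕ} (x₀ : TorusSite 4 L) (p q : Fin 4 → ℕ) (D : ℕ)
    (h : ∀ i, p i ≤ q i + D ∧ q i ≤ p i + D) :
    torusDist (x₀ + fun i => (p i : ZMod L)) (x₀ + fun i => (q i : ZMod L)) ≤ D := by
  unfold torusDist torusNorm
  refine Finset.sup_le fun i _ => ?_
  have e : ((x₀ + fun i => (p i : ZMod L)) - (x₀ + fun i => (q i : ZMod L))) i =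
      (p i : ZMod L) - (q i : ZMod L) := by simp
  dsimp only
  rw [e]
  exact cycAbs_natCast_sub_le (L := L) (p i) (q i) D (h i).1 (h i).2

/-- **Offsets of ball sites.** If `torusDist x z + 1 ≤ R` and the cube does not wrap
(`2R + 1 ≤ L`), the offset representatives of `z` from the corner `x - (R,R,R,R)` are within
`torusDist x z` of the centre value `R`. -/
theorem offset_bounds {L : ℕ} [NeZero L] (x : TorusSite 4 L) (R : ℕ) (hRL : 2 * R + 1 ≤ L)
    (z : TorusSite 4 L) (hz : torusDist x z + 1 ≤ R) (i : Fin 4) :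
    R ≤ ((z - (x - fun _ : Fin 4 => (R : ZMod L))) i).val + torusDist x z ∧
      ((z - (x - fun _ : Fin 4 => (R : ZMod L))) i).val ≤ R + torusDist x z := by
  set D := torusDist x z with hD
  have hcoord : (z - (x - fun _ : Fin 4 => (R : ZMod L))) i = (z - x) i + (R : ZMod L) := by
    simp only [Pi.sub_apply]
    ring
  set a : ZMod L := (z - x) i with ha
  have habs : a.valMinAbs.natAbs ≤ D := by
    rw [ZMod.valMinAbs_natAbs_eq_min]
    have h : min a.val (L - a.val) ≤ torusNorm (z - x) := by
      unfold torusNorm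
      exact Finset.le_sup (f := fun j => min ((z - x) j).val (L - ((z - x) j).val))
        (Finset.mem_univ i)
    rw [hD, torusDist_comm']
    exact h
  have hval : (((z - (x - fun _ : Fin 4 => (R : ZMod L))) i).val : ℤ) = a.valMinAbs + R := by
    rw [hcoord]
    have e : a + (R : ZMod L) = ((a.valMinAbs + R : ℤ) : ZMod L) := by
      rw [Int.cast_add, Int.cast_natCast, ZMod.coe_valMinAbs]
    rw [e, ZMod.val_intCast]
    apply Int.emod_eq_of_lt <;> omega
  omega

/-! ### Moving links along the axes towards the tree -/

section Bound

variable {L : ℕ} {U : GaugeConfig 4 L SU3} {x : TorusSite 4 L} {R : ℕ} {η : ℝ}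
  {site : (Fin 4 → ℕ) → TorusSite 4 L} {g : TorusSite 4 L → SU3} {F : SU3 → ℝ}
  (hRL : 2 * R + 1 ≤ L)
  (hη : ∀ y, torusDist x y ≤ R → ∀ μ ν : Fin 4, F (plaquetteHolonomy U y μ ν) ≤ η)
  (hsite : ∀ (m : Fin 4 → ℕ) (μ : Fin 4), site (m + Pi.single μ 1) = Site.shift (site m) μ)
  (hdist : ∀ q : Fin 4 → ℕ, (∀ i, R ≤ q i + R ∧ q i ≤ R + R) → torusDist x (site q) ≤ R)
  (htl : ∀ (q : Fin 4 → ℕ) (μ : Fin 4), (∀ i, q i < L) → q μ + 1 < L →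
    (∀ i, μ < i → q i = R) → gaugeTransform g U (site q, μ) = 1)
  (hFt : ∀ (y : TorusSite 4 L) (ν μ : Fin 4), gaugeTransform g U (y, ν) = 1 →
    gaugeTransform g U (Site.shift y μ, ν) = 1 →
    F (gaugeTransform g U (Site.shift y ν, μ)) ≤
        F (plaquetteHolonomy U y ν μ) + F (gaugeTransform g U (y, μ)) ∧
      F (gaugeTransform g U (y, μ)) ≤
        F (plaquetteHolonomy U y ν μ) + F (gaugeTransform g U (Site.shift y ν, μ)))
include hRL hη hsite hdist htl hFt

/-!
In this section `site m` is the site at offset `m ∈ ℕ⁴` from the corner of the cube (hypotheses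
`hsite`, `hdist`), `g` is any gauge that gauges the comb tree centred at the offset `(R,R,R,R)` to `1`
(hypothesis `htl`: the link `(site q, μ)` is a tree link when `q i = R` for all `i > μ`), and `F` is
any cost function satisfying the transport inequalities `hFt` (in the application, `‖· - 1‖_F` on
`SU(3)`, by `norm_transport`) with `F(U_p) ≤ η` for the plaquettes of the ball (hypothesis `hη`).
-/

/-- One step along the axis `ν > μ` inside the cube costs at most `η`, in either direction. -/
theorem step_bound {μ ν : Fin 4} (hμν : μ < ν) (q : Fin 4 → ℕ) (hq : ∀ i, q i + 1 ≤ 2 * R)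
    (htree : ∀ i, ν < i → q i = R) :
    F (gaugeTransform g U (site (q + Pi.single ν 1), μ)) ≤ η + F (gaugeTransform g U (site q, μ)) ∧
      F (gaugeTransform g U (site q, μ)) ≤ η + F (gaugeTransform g U (site (q + Pi.single ν 1), μ)) := by
  have h1 : gaugeTransform g U (site q, ν) = 1 :=
    htl q ν (fun i => by have := hq i; omega) (by have := hq ν; omega) htree
  have h2 : gaugeTransform g U (Site.shift (site q) μ, ν) = 1 := by
    rw [← hsite]
    refine htl _ ν (fun i => ?_) ?_ (fun i hi => ?_)
    · by_cases h : i = μ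
      · subst h; have := hq i; simp; omega
      · have := hq i; simp [Pi.single_eq_of_ne h]; omega
    · have := hq ν; simp [Pi.single_eq_of_ne hμν.ne']; omega
    · simp [Pi.single_eq_of_ne (hμν.trans hi).ne', htree i hi]
  have hT := hFt (site q) ν μ h1 h2
  rw [← hsite] at hT
  have hPl : F (plaquetteHolonomy U (site q) ν μ) ≤ η :=
    hη _ (hdist q fun i => by have := hq i; omega) ν μ
  constructor <;> linarith [hT.1, hT.2]

/-- Moving the `ν`-th coordinate `s` steps away from the central value costs at most `s η`. -/
theorem axis_bound {μ ν : Fin 4} (hμν : μ < ν) (p : Fin 4 → ℕ) (hp : ∀ i, p i + 1 ≤ 2 * R)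
    (htree : ∀ i, ν < i → p i = R) (s : ℕ) :
    ∀ t : ℕ, s + 1 ≤ R → (t = R + s ∨ t + s = R) →
      F (gaugeTransform g U (site (Function.update p ν t), μ)) ≤
        F (gaugeTransform g U (site (Function.update p ν R), μ)) + s * η := by
  -- the generic step between the heights `t` and `t + 1`
  have hst : ∀ t, t + 2 ≤ 2 * R →
      (F (gaugeTransform g U (site (Function.update p ν (t + 1)), μ)) ≤
          η + F (gaugeTransform g U (site (Function.update p ν t), μ)) ∧
        F (gaugeTransform g U (site (Function.update p ν t), μ)) ≤
          η + F (gaugeTransform g U (site (Function.update p ν (t + 1)), μ))) := by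
    intro t ht
    have h := step_bound hRL hη hsite hdist htl hFt hμν (Function.update p ν t) (fun i => ?_)
      (fun i hi => ?_)
    · rwa [update_add_single] at h
    · by_cases h : i = ν
      · subst h; simp; omega
      · rw [Function.update_of_ne h]; exact hp i
    · rw [Function.update_of_ne hi.ne']; exact htree i hi
  induction s with
  | zero =>
    intro t _ ht
    rcases ht with rfl | h
    · simp
    · rw [add_zero] at h; subst h; simp
  | succ s ih =>
    intro t hs ht
    rcases ht with rfl | h
    · have h1 := (hst (R + s) (by omega)).1
      have h2 := ih (R + s) (by omega) (Or.inl rfl)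
      rw [← add_assoc]
      push_cast
      linarith
    · have h1 := (hst t (by omega)).2
      have h2 := ih (t + 1) (by omega) (Or.inr (by omega))
      push_cast
      linarith

/-- **Comb bound.** For an offset `p` within `D < R` of the centre whose coordinates of index `≥ k`
beyond `μ` are central, the gauge-transformed link `(site p, μ)` costs at most `k D η`. -/
theorem comb_bound (hη0 : 0 ≤ η) (hF1 : F 1 = 0) {D : ℕ} (hD : D + 1 ≤ R) (k : ℕ) :
    ∀ (μ : Fin 4) (p : Fin 4 → ℕ), (∀ i, R ≤ p i + D ∧ p i ≤ R + D) →
      (∀ i : Fin 4, k ≤ i.val → μ < i → p i = R) →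
      F (gaugeTransform g U (site p, μ)) ≤ k * (D * η) := by
  have hDη : 0 ≤ (D : ℝ) * η := mul_nonneg (Nat.cast_nonneg D) hη0
  induction k with
  | zero =>
    intro μ p hp htree
    rw [htl p μ (fun i => by have := hp i; omega) (by have := hp μ; omega)
      (fun i hi => htree i (Nat.zero_le _) hi), hF1]
    simp
  | succ k ih =>
    intro μ p hp htree
    by_cases hk : k < 4
    · obtain ⟨ν, hν⟩ : ∃ ν : Fin 4, ν.val = k := ⟨⟨k, hk⟩, rfl⟩
      by_cases hμν : μ < ν
      · -- peel off the axis `ν`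
        have h1 := ih μ (Function.update p ν R) (fun i => ?_) (fun i hi hμi => ?_)
        · obtain ⟨s, hs, hst⟩ : ∃ s, s ≤ D ∧ (p ν = R + s ∨ p ν + s = R) := by
            rcases le_total R (p ν) with h | h
            · exact ⟨p ν - R, by have := hp ν; omega, Or.inl (by omega)⟩
            · exact ⟨R - p ν, by have := hp ν; omega, Or.inr (by omega)⟩
          have h2 := axis_bound hRL hη hsite hdist htl hFt hμν p
            (fun i => by have := hp i; omega)
            (fun i hi => htree i (by have := Fin.lt_def.mp hi; omega) (hμν.trans hi)) s (p ν)
            (by omega) hst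
          rw [Function.update_eq_self] at h2
          have hs' : (s : ℝ) * η ≤ D * η := mul_le_mul_of_nonneg_right (by exact_mod_cast hs) hη0
          push_cast at h1 ⊢
          linarith
        · by_cases h : i = ν
          · subst h; rw [Function.update_self]; omega
          · rw [Function.update_of_ne h]; exact hp i
        · by_cases h : i = ν
          · subst h; exact Function.update_self _ _ _
          · rw [Function.update_of_ne h]
            refine htree i ?_ hμi
            have : i.val ≠ ν.val := fun e => h (Fin.ext e)
            omega
      · have h1 := ih μ p hp (fun i hi hμi => htree i ?_ hμi)
        · push_cast; linarith
        · have : i ≠ ν := fun e => hμν (e ▸ hμi)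
          have : i.val ≠ ν.val := fun e => this (Fin.ext e)
          omega
    · have h1 := ih μ p hp (fun i hi hμi => htree i (by have := i.isLt; omega) hμi)
      push_cast; linarith

end Bound

end CombGauge

/-- **Registered sub-goal `stub_combGaugeAxial` (axial induction of the comb gauge).**  For ANY
parametrisation `site` of cube sites by offsets compatible with shifts, ANY gauge `g` that gauges the
comb tree centred at the offset `(R,R,R,R)` to `1`, and ANY cost `F` with `F 1 = 0` obeying the two
transport inequalities, if every plaquette of the ball costs at most `η` then every link at an offset
within `D < R` of the centre costs at most `4 D η` (`CombGauge.comb_bound` with `k = 4`). -/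
theorem stub_combGaugeAxial :
    ∀ (L : ℕ) (U : GaugeConfig 4 L SU3) (x : TorusSite 4 L) (R : ℕ) (η : ℝ) (site : (Fin 4 → ℕ) → TorusSite 4 L) (g : TorusSite 4 L → SU3) (F : SU3 → ℝ), 2 * R + 1 ≤ L → 0 ≤ η → F 1 = 0 → (∀ y : TorusSite 4 L, torusDist x y ≤ R → ∀ μ ν : Fin 4, F (plaquetteHolonomy U y μ ν) ≤ η) → (∀ (m : Fin 4 → ℕ) (μ : Fin 4), site (m + Pi.single μ 1) = Site.shift (site m) μ) → (∀ q : Fin 4 → ℕ, (∀ i, R ≤ q i + R ∧ q i ≤ R + R) → torusDist x (site q) ≤ R) → (∀ (q : Fin 4 → ℕ) (μ : Fin 4), (∀ i, q i < L) → q μ + 1 < L → (∀ i, μ < i → q i = R) → gaugeTransform g U (site q, μ) = 1) → (∀ (y : TorusSite 4 L) (ν μ : Fin 4), gaugeTransform g U (y, ν) = 1 → gaugeTransform g U (Site.shift y μ, ν) = 1 → F (gaugeTransform g U (Site.shift y ν, μ)) ≤ F (plaquetteHolonomy U y ν μ) + F (gaugeTransform g U (y, μ)) ∧ F (gaugeTransform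 g U (y, μ)) ≤ F (plaquetteHolonomy U y ν μ) + F (gaugeTransform g U (Site.shift y ν, μ))) → ∀ (D : ℕ), D + 1 ≤ R → ∀ (μ : Fin 4) (p : Fin 4 → ℕ), (∀ i, R ≤ p i + D ∧ p i ≤ R + D) → F (gaugeTransform g U (site p, μ)) ≤ 4 * ((D : ℝ) * η) := by
  intro L U x R η site g F hRL hη0 hF1 hη hsite hdist htl hFt D hD μ p hp
  have h := CombGauge.comb_bound hRL hη hsite hdist htl hFt hη0 hF1 hD 4 μ p hp
    (fun i hi _ => absurd i.isLt (by omega))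
  exact_mod_cast h

end Summit.QuantumFields.QCD.Cruxes.SmallFieldUltracontractivity.PointCentredAxialParabolic

end
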